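import Summits.RiemannHypothesis.RiemannHypothesis.Theorems.TiltedLandingLaw421R3IsoTilt1
import Literature.NumberTheory.LFunctions.XiTaylor

/-! # TiltedLandingLaw421 — W-08 round 3: ISOLATED PAIR, MODULE 2 of 2 — §K.25 PAIR FACTORISATION, §K.26 DIAMETER REALNESS, §K.27 THE G-ONLY FORM
(C4 «kernel desk» §K.22 series, rh-idea-6 g26 rev f `isoTiltK22-revf-W08-C4-rh-idea-6-g26.lean` 0efff3078a3d552c lines 362–680, byte-identical; split for landing by
C4 g27 per director (CA337) «≤ 400 l»; imports MODULE 1 `…R3IsoTilt1` ((CA352) target name; = rev f lines 1–361: `pairQ`, `existsUnique_crit_of_isolated`, `crit_im_eq_zero_of_real`,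
`tilt_of_isolated`, `tiltReady_of_nlShape`, `readyR2_of_isolated`, `hsmall_of_field_bound`, …) BY MODULE NAME — if the lead lands module 1 under another
name, change line 1 only.)

§K.25: a SIMPLE conjugate pair `a ± ib` that is `G`'s only zero set in the ball splits off, `G = q·h`, `h := dslope (dslope G (a+ib)) (a−ib)` holomorphic and
zero-free (`exists_pair_factor`), and the §K.22 smallness follows from a bound on the logarithmic derivative of `G` itself (`hsmall_of_logDeriv`);
§K.26: for real `G` (`G ∘ conj = conj ∘ G`) the cofactor values `h x`, `h′ x`, `h″ x` are real on the diameter (`hreal_of_conjSym`), so the realness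
hypotheses of `tilt_of_isolated` / `readyR2_of_isolated` are discharged (`tilt_of_isolated'`, `readyR2_of_isolated'`, `readyR2_of_isolated_real`);
§K.27: every hypothesis stated on `G := f^{(j)}` alone (`exists_pair_factor_real`, `cofactor_eq_quot`, ★`readyR2_of_tracked_pair`).
Farm evidence: the COMPOSITE module 1 ++ module 2 is rev f itself (rc 0 · 0 sorry · `readyR2_of_tracked_pair` STD, g26 SHAS row 04:50Z; re-checked by g27 over
the current tree, see g27/SHAS.txt). Nothing here bears on the truth of RH; RH is NOT proved; 24774 OPEN. 
v3 (dedup pre-check after `…R3IsoTilt1` landed p765755): `conjSym_iteratedDeriv` DELETED — it restated the Literature fact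
`Literature.NumberTheory.LFunctions.iteratedDeriv_conj_of_conj` [Titchmarsh 1986, §2.1], now cited by name (import added); no other decl has a tree twin (rg).
-/

namespace RhW08.IsolatedTilt

open Complex Metric Set
open scoped ComplexConjugate

/-! ## §K.25 PAIR FACTORISATION (frame bookkeeping for §K.22): a SIMPLE conjugate pair `a ± ib` that is `G`'s only zero set in the ball splits off,
`G = q·h` with `h` holomorphic and zero-free on the ball — `h := dslope (dslope G (a+ib)) (a−ib)` (Mathlib's removable-singularity `dslope`). -/

/-- (K) the pair factor splits: `(z − (a + ib))·(z − (a − ib)) = q z`. -/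
theorem pairQ_eq_mul (a b : ℝ) (z : ℂ) : pairQ a b z = (z - (a + b * I)) * (z - (a - b * I)) := by
  unfold pairQ
  have hI : I * I = -1 := I_mul_I
  ring_nf
  rw [I_sq]
  ring

/-- ★★★ §K.25 **PAIR FACTORISATION**: `G` holomorphic on `ball a ρ`, `|b| < ρ`, `b ≠ 0`, `G (a ± ib) = 0` with `G′ (a ± ib) ≠ 0` (simple), and no other zero of `G`
in the ball ⇒ `∃ h`, holomorphic and zero-free on the ball, with `G = q·h` there (indeed everywhere). -/
theorem exists_pair_factor {G : ℂ → ℂ} {a b ρ : ℝ} (hb : b ≠ 0) (hbρ : |b| < ρ)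
    (hG : DifferentiableOn ℂ G (ball (a : ℂ) ρ))
    (hG1 : G (a + b * I) = 0) (hG2 : G (a - b * I) = 0)
    (hG1' : deriv G (a + b * I) ≠ 0) (hG2' : deriv G (a - b * I) ≠ 0)
    (honly : ∀ z ∈ ball (a : ℂ) ρ, G z = 0 → z = a + b * I ∨ z = a - b * I) :
    ∃ h : ℂ → ℂ, DifferentiableOn ℂ h (ball (a : ℂ) ρ) ∧ (∀ z ∈ ball (a : ℂ) ρ, h z ≠ 0) ∧
      ∀ z ∈ ball (a : ℂ) ρ, G z = pairQ a b z * h z := by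
  set z₁ : ℂ := a + b * I with hz₁
  set z₂ : ℂ := a - b * I with hz₂
  have h12 : z₁ ≠ z₂ := by
    intro h
    have := congrArg Complex.im h
    simp [hz₁, hz₂] at this
    exact hb (by linarith)
  have hmem1 : z₁ ∈ ball (a : ℂ) ρ := by
    rw [mem_ball, dist_eq_norm, hz₁, show (a : ℂ) + b * I - a = b * I by ring, norm_mul, Complex.norm_I, mul_one,
      Complex.norm_real, Real.norm_eq_abs]
    exact hbρ
  have hmem2 : z₂ ∈ ball (a : ℂ) ρ := by
    rw [mem_ball, dist_eq_norm, hz₂, show (a : ℂ) - b * I - a = -(b * I) by ring, norm_neg, norm_mul, Complex.norm_I, mul_one,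
      Complex.norm_real, Real.norm_eq_abs]
    exact hbρ
  set D : ℂ → ℂ := dslope G z₁ with hD
  set h : ℂ → ℂ := dslope D z₂ with hh
  have hDdiff : DifferentiableOn ℂ D (ball (a : ℂ) ρ) :=
    (Complex.differentiableOn_dslope (isOpen_ball.mem_nhds hmem1)).2 hG
  have hhdiff : DifferentiableOn ℂ h (ball (a : ℂ) ρ) :=
    (Complex.differentiableOn_dslope (isOpen_ball.mem_nhds hmem2)).2 hDdiff
  -- the two factorisation identities (valid everywhere)
  have hGD : ∀ z, G z = (z - z₁) * D z := by
    intro z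
    have := sub_smul_dslope_of_zero (f := G) (a := z₁) hG1 z
    rw [smul_eq_mul] at this
    exact this.symm
  have hD2 : D z₂ = 0 := by
    have := hGD z₂
    rw [hG2] at this
    rcases mul_eq_zero.mp this.symm with h0 | h0
    · exact absurd (sub_eq_zero.mp h0) h12.symm
    · exact h0
  have hDh : ∀ z, D z = (z - z₂) * h z := by
    intro z
    have := sub_smul_dslope_of_zero (f := D) (a := z₂) hD2 z
    rw [smul_eq_mul] at this
    exact this.symm
  have hfac : ∀ z, G z = pairQ a b z * h z := by
    intro z
    rw [pairQ_eq_mul, hGD z, hDh z]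
    ring
  -- values of h at the two zeros
  have hD1 : D z₁ = deriv G z₁ := dslope_same G z₁
  have hh1 : h z₁ ≠ 0 := by
    intro h0
    have := hDh z₁
    rw [h0, mul_zero, hD1] at this
    exact hG1' this
  have hh2 : h z₂ ≠ 0 := by
    -- h z₂ = deriv D z₂ and deriv G z₂ = D z₂ + (z₂ − z₁)·deriv D z₂ = (z₂ − z₁)·deriv D z₂
    have hhz2 : h z₂ = deriv D z₂ := dslope_same D z₂
    have hDat : HasDerivAt D (deriv D z₂) z₂ := (hDdiff.differentiableAt (isOpen_ball.mem_nhds hmem2)).hasDerivAt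
    have hprod : HasDerivAt (fun z => (z - z₁) * D z) (1 * D z₂ + (z₂ - z₁) * deriv D z₂) z₂ :=
      ((hasDerivAt_id z₂).sub_const z₁).mul hDat
    have hfun : G = fun z => (z - z₁) * D z := funext hGD
    have hderiv : deriv G z₂ = (z₂ - z₁) * deriv D z₂ := by
      rw [hfun, hprod.deriv, hD2]; ring
    intro h0
    rw [hhz2] at h0
    rw [h0, mul_zero] at hderiv
    exact hG2' hderiv
  refine ⟨h, hhdiff, fun z hz h0 => ?_, fun z _ => hfac z⟩
  have hGz : G z = 0 := by rw [hfac z, h0, mul_zero]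
  rcases honly z hz hGz with rfl | rfl
  · exact hh1 h0
  · exact hh2 h0


/-- ★★ §K.25b the CIRCLE SMALLNESS IN TERMS OF `G` ALONE: on `‖z − a‖ = r` (inside the ball, off the pair: `q z ≠ 0`) one has `q·h′/h = q·G′/G − 2(z − a)`,
so `‖q·G′/G − q′‖ < 2r` on the circle is exactly the smallness hypothesis of `existsUnique_crit_of_isolated` (the log-derivative of `G` minus that of its pair factor). -/
theorem hsmall_of_logDeriv {G h : ℂ → ℂ} {a b r ρ : ℝ} (hrρ : r < ρ)
    (hh : DifferentiableOn ℂ h (ball (a : ℂ) ρ)) (hh0 : ∀ z ∈ ball (a : ℂ) ρ, h z ≠ 0)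
    (hG : ∀ z ∈ ball (a : ℂ) ρ, G z = pairQ a b z * h z)
    (hq : ∀ z : ℂ, ‖z - a‖ = r → pairQ a b z ≠ 0)
    (hcirc : ∀ z : ℂ, ‖z - a‖ = r → ‖pairQ a b z * (deriv G z / G z) - 2 * (z - a)‖ < 2 * r) :
    ∀ z : ℂ, ‖z - a‖ = r → ‖pairQ a b z * (deriv h z / h z)‖ < 2 * r := by
  intro z hz
  have hzb : z ∈ ball (a : ℂ) ρ := by
    rw [mem_ball, dist_eq_norm]; linarith
  have hqz := hq z hz
  have hhz := hh0 z hzb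
  have hGz : G z = pairQ a b z * h z := hG z hzb
  have hdG := deriv_pair_mul hh hG hzb
  have key : pairQ a b z * (deriv h z / h z) = pairQ a b z * (deriv G z / G z) - 2 * (z - a) := by
    rw [hdG, hGz]
    field_simp
    ring
  rw [key]
  exact hcirc z hz

/-- (K) off the pair, `q z ≠ 0`: on the circle `‖z − a‖ = r` this holds as soon as `r ≠ |b|`… in fact whenever `z` is not `a ± ib`; here the convenient
sufficient condition `|b| < r` (the pair strictly inside the Rouché circle). -/
theorem pairQ_ne_zero_of_circle {a b r : ℝ} (hbr : |b| < r) {z : ℂ} (hz : ‖z - a‖ = r) : pairQ a b z ≠ 0 := by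
  rw [pairQ_eq_mul]
  have h1 : z - (a + b * I) ≠ 0 := by
    intro h0
    have hz' : z - a = b * I := by linear_combination h0
    rw [hz', norm_mul, Complex.norm_I, mul_one, Complex.norm_real, Real.norm_eq_abs] at hz
    linarith
  have h2 : z - (a - b * I) ≠ 0 := by
    intro h0
    have hz' : z - a = -(b * I) := by linear_combination h0
    rw [hz', norm_neg, norm_mul, Complex.norm_I, mul_one, Complex.norm_real, Real.norm_eq_abs] at hz
    linarith
  exact mul_ne_zero h1 h2

/-! ## §K.26 DIAMETER REALNESS IS AUTOMATIC: if `G` is real (`G ∘ conj = conj ∘ G`) and `G = q·h` on the ball with `b ≠ 0`, then `h`, `h′`, `h″` are real on the real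
diameter — so the hypothesis `hreal` of `tilt_of_isolated` / `readyR2_of_isolated` is discharged (`tilt_of_isolated'`, `readyR2_of_isolated'`). -/

/-- (K) conjugation symmetry passes to the derivative (Mathlib `deriv_conj_conj`, unconditional). -/
theorem conjSym_deriv {F : ℂ → ℂ} (hF : ∀ z : ℂ, F (conj z) = conj (F z)) : ∀ z : ℂ, deriv F (conj z) = conj (deriv F z) := by
  have hfun : (conj ∘ F ∘ conj : ℂ → ℂ) = F := by
    funext z
    simp only [Function.comp_apply, hF, Complex.conj_conj]
  intro z
  have h := congrFun (deriv_conj_conj (f := F)) (conj z)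
  rw [hfun] at h
  simpa only [Function.comp_apply, Complex.conj_conj] using h

/-- (K) a conjugation-symmetric function is real on the real axis. -/
theorem im_eq_zero_of_conjSym {F : ℂ → ℂ} (hF : ∀ z : ℂ, F (conj z) = conj (F z)) (x : ℝ) : (F x).im = 0 := by
  have h := hF x
  rw [Complex.conj_ofReal] at h
  exact Complex.conj_eq_iff_im.mp h.symm

/-- (K) `q` is real: `q (conj z) = conj (q z)`. -/
theorem pairQ_conj (a b : ℝ) (z : ℂ) : pairQ a b (conj z) = conj (pairQ a b z) := by
  simp only [pairQ, map_add, map_pow, map_sub, Complex.conj_ofReal]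

/-- (K) `q` is continuous. -/
theorem continuous_pairQ (a b : ℝ) : Continuous (pairQ a b) := by
  unfold pairQ
  fun_prop

/-- ★★ §K.26 **`h`, `h′`, `h″` ARE REAL ON THE DIAMETER** when `G` is real and `G = q·h` on the ball (`b ≠ 0`, `r ≤ ρ`): `h` agrees near each real `x` with the
conjugation-symmetric `F := G/q`, whose derivatives of all orders are conjugation-symmetric, hence real on `ℝ`. -/
theorem hreal_of_conjSym {G h : ℂ → ℂ} {a b r ρ : ℝ} (hb : b ≠ 0) (hrρ : r ≤ ρ)
    (hG : ∀ z ∈ ball (a : ℂ) ρ, G z = pairQ a b z * h z)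
    (hGreal : ∀ z : ℂ, G (conj z) = conj (G z)) :
    ∀ x : ℝ, |x - a| < r → (h x).im = 0 ∧ (deriv h x).im = 0 ∧ (deriv (deriv h) x).im = 0 := by
  intro x hx
  set F : ℂ → ℂ := fun z => G z / pairQ a b z with hFdef
  have hF : ∀ z : ℂ, F (conj z) = conj (F z) := by
    intro z
    simp only [hFdef, hGreal, pairQ_conj, map_div₀]
  have hF1 := conjSym_deriv hF
  have hF2 := conjSym_deriv hF1
  -- `h = F` on the open set `ball ∩ {q ≠ 0}`, which contains the real point `x`
  have hxball : (x : ℂ) ∈ ball (a : ℂ) ρ := by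
    rw [mem_ball, dist_eq_norm, show (x : ℂ) - a = ((x - a : ℝ) : ℂ) by push_cast; ring, Complex.norm_real, Real.norm_eq_abs]
    exact lt_of_lt_of_le hx hrρ
  have hqx : pairQ a b (x : ℂ) ≠ 0 := by
    rw [pairQ_ofReal]
    have : 0 < (x - a) ^ 2 + b ^ 2 := by positivity
    exact_mod_cast this.ne'
  have hU : IsOpen (ball (a : ℂ) ρ ∩ {z : ℂ | pairQ a b z ≠ 0}) :=
    isOpen_ball.inter (isOpen_ne_fun (continuous_pairQ a b) continuous_const)
  have hxU : (x : ℂ) ∈ ball (a : ℂ) ρ ∩ {z : ℂ | pairQ a b z ≠ 0} := ⟨hxball, hqx⟩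
  have hEq : h =ᶠ[nhds (x : ℂ)] F := by
    refine Filter.eventually_of_mem (hU.mem_nhds hxU) ?_
    rintro z ⟨hz, hqz⟩
    have hqz' : pairQ a b z ≠ 0 := hqz
    have := hG z hz
    simp only [hFdef]
    rw [this, mul_div_cancel_left₀ _ hqz']
  have e0 : h x = F x := hEq.eq_of_nhds
  have e1 : deriv h x = deriv F x := hEq.deriv_eq
  have e2 : deriv (deriv h) x = deriv (deriv F) x := hEq.deriv.deriv_eq
  refine ⟨?_, ?_, ?_⟩
  · rw [e0]; exact im_eq_zero_of_conjSym hF x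
  · rw [e1]; exact im_eq_zero_of_conjSym hF1 x
  · rw [e2]; exact im_eq_zero_of_conjSym hF2 x

/-- ★★★ §K.26b `tilt_of_isolated` WITHOUT the realness hypothesis on `h` (it follows from `G`'s). -/
theorem tilt_of_isolated' {G h : ℂ → ℂ} {a b r ρ : ℝ} (hr : 0 < r) (hrρ : r < ρ) (hb : 0 < b)
    (hh : DifferentiableOn ℂ h (ball (a : ℂ) ρ)) (hh0 : ∀ z ∈ ball (a : ℂ) ρ, h z ≠ 0)
    (hG : ∀ z ∈ ball (a : ℂ) ρ, G z = pairQ a b z * h z)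
    (hsmall : ∀ z : ℂ, ‖z - a‖ = r → ‖pairQ a b z * (deriv h z / h z)‖ < 2 * r)
    (hGreal : ∀ z : ℂ, G (conj z) = conj (G z))
    (hsmall2 : ∀ x : ℝ, |x - a| < r →
      ((x - a) ^ 2 + b ^ 2) * (|(deriv (deriv h) x).re| * |(h x).re| + 2 * (deriv h x).re ^ 2) ≤ 2 * (h x).re ^ 2) :
    ∃ x : ℝ, |x - a| < r ∧ deriv G x = 0 ∧ (G x).re ≠ 0 ∧ 0 ≤ (G x).re * (deriv (deriv G) x).re :=
  tilt_of_isolated hr hrρ hb hh hh0 hG hsmall hGreal (hreal_of_conjSym hb.ne' hrρ.le hG hGreal) hsmall2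

/-- ★★★ §K.26c `readyR2_of_isolated` WITHOUT the realness hypothesis on `h`: a tracked simple conjugate pair of `f^{(j)}` whose cofactor `h` passes the two
smallness tests, inside the LAW's range ⇒ `TiltReady` and `ReadyR2` at level `j`. -/
theorem readyR2_of_isolated' {f h : ℂ → ℂ} {j : ℕ} {a b r ρ x₀ : ℝ} (η s hmax R Hs : ℝ) (B : ℕ) (u : ℂ)
    (hr : 0 < r) (hrρ : r < ρ) (hb : 0 < b)
    (hh : DifferentiableOn ℂ h (ball (a : ℂ) ρ)) (hh0 : ∀ z ∈ ball (a : ℂ) ρ, h z ≠ 0)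
    (hG : ∀ z ∈ ball (a : ℂ) ρ, iteratedDeriv j f z = pairQ a b z * h z)
    (hsmall : ∀ z : ℂ, ‖z - a‖ = r → ‖pairQ a b z * (deriv h z / h z)‖ < 2 * r)
    (hGreal : ∀ z : ℂ, iteratedDeriv j f (conj z) = conj (iteratedDeriv j f z))
    (hsmall2 : ∀ x : ℝ, |x - a| < r →
      ((x - a) ^ 2 + b ^ 2) * (|(deriv (deriv h) x).re| * |(h x).re| + 2 * (deriv h x).re ^ 2) ≤ 2 * (h x).re ^ 2)
    (hwin : |a - x₀| + r ≤ ((j : ℝ) + 3) * R / 2) :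
    RhW08.StSwap.TiltReady η f x₀ s hmax R Hs B j u ∧ RhW08.StSwap.ReadyR2 η f x₀ s hmax R Hs B j u :=
  readyR2_of_isolated η s hmax R Hs B u hr hrρ hb hh hh0 hG hsmall hGreal (hreal_of_conjSym hb.ne' hrρ.le hG hGreal) hsmall2 hwin

/-- ★★★ §K.26e the tilt lemma from `f` real: `readyR2_of_isolated'` with `hGreal` discharged by the Literature fact `Literature.NumberTheory.LFunctions.iteratedDeriv_conj_of_conj` (module XiTaylor) [Titchmarsh 1986, §2.1]. -/
theorem readyR2_of_isolated_real {f h : ℂ → ℂ} {j : ℕ} {a b r ρ x₀ : ℝ} (η s hmax R Hs : ℝ) (B : ℕ) (u : ℂ)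
    (hf : ∀ z : ℂ, f (conj z) = conj (f z))
    (hr : 0 < r) (hrρ : r < ρ) (hb : 0 < b)
    (hh : DifferentiableOn ℂ h (ball (a : ℂ) ρ)) (hh0 : ∀ z ∈ ball (a : ℂ) ρ, h z ≠ 0)
    (hG : ∀ z ∈ ball (a : ℂ) ρ, iteratedDeriv j f z = pairQ a b z * h z)
    (hsmall : ∀ z : ℂ, ‖z - a‖ = r → ‖pairQ a b z * (deriv h z / h z)‖ < 2 * r)
    (hsmall2 : ∀ x : ℝ, |x - a| < r →
      ((x - a) ^ 2 + b ^ 2) * (|(deriv (deriv h) x).re| * |(h x).re| + 2 * (deriv h x).re ^ 2) ≤ 2 * (h x).re ^ 2)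
    (hwin : |a - x₀| + r ≤ ((j : ℝ) + 3) * R / 2) :
    RhW08.StSwap.TiltReady η f x₀ s hmax R Hs B j u ∧ RhW08.StSwap.ReadyR2 η f x₀ s hmax R Hs B j u :=
  readyR2_of_isolated' η s hmax R Hs B u hr hrρ hb hh hh0 hG hsmall (Literature.NumberTheory.LFunctions.iteratedDeriv_conj_of_conj hf j) hsmall2 hwin

/-! ## §K.27 THE G-ONLY FORM: every hypothesis stated on `G := f^{(j)}` (and the explicit quotient `G/q`), the cofactor `h` eliminated. -/

/-- (K) for a real `G`, the UPPER zero's data give the lower one's: `G (a − ib) = 0` and `G′(a − ib) ≠ 0`. -/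
theorem exists_pair_factor_real {G : ℂ → ℂ} {a b ρ : ℝ} (hGreal : ∀ z : ℂ, G (conj z) = conj (G z)) (hb : b ≠ 0) (hbρ : |b| < ρ)
    (hG : DifferentiableOn ℂ G (ball (a : ℂ) ρ))
    (hG1 : G (a + b * I) = 0) (hG1' : deriv G (a + b * I) ≠ 0)
    (honly : ∀ z ∈ ball (a : ℂ) ρ, G z = 0 → z = a + b * I ∨ z = a - b * I) :
    ∃ h : ℂ → ℂ, DifferentiableOn ℂ h (ball (a : ℂ) ρ) ∧ (∀ z ∈ ball (a : ℂ) ρ, h z ≠ 0) ∧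
      ∀ z ∈ ball (a : ℂ) ρ, G z = pairQ a b z * h z := by
  have hconj : conj ((a : ℂ) + b * I) = (a : ℂ) - b * I := by
    simp [map_add, map_mul, Complex.conj_ofReal, Complex.conj_I]; ring
  have hG2 : G (a - b * I) = 0 := by
    rw [← hconj, hGreal, hG1, map_zero]
  have hG2' : deriv G (a - b * I) ≠ 0 := by
    rw [← hconj, conjSym_deriv hGreal]
    exact (map_ne_zero _).mpr hG1'
  exact exists_pair_factor hb hbρ hG hG1 hG2 hG1' hG2' honly

/-- (K) on the real diameter the cofactor AGREES with the explicit quotient `G/q` to second order. -/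
theorem cofactor_eq_quot {G h : ℂ → ℂ} {a b r ρ : ℝ} (hb : b ≠ 0) (hrρ : r ≤ ρ)
    (hG : ∀ z ∈ ball (a : ℂ) ρ, G z = pairQ a b z * h z) {x : ℝ} (hx : |x - a| < r) :
    h x = G x / pairQ a b x ∧ deriv h x = deriv (fun z => G z / pairQ a b z) x ∧
      deriv (deriv h) x = deriv (deriv (fun z => G z / pairQ a b z)) x := by
  have hxball : (x : ℂ) ∈ ball (a : ℂ) ρ := by
    rw [mem_ball, dist_eq_norm, show (x : ℂ) - a = ((x - a : ℝ) : ℂ) by push_cast; ring, Complex.norm_real, Real.norm_eq_abs]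
    exact lt_of_lt_of_le hx hrρ
  have hqx : pairQ a b (x : ℂ) ≠ 0 := by
    rw [pairQ_ofReal]
    have : 0 < (x - a) ^ 2 + b ^ 2 := by positivity
    exact_mod_cast this.ne'
  have hU : IsOpen (ball (a : ℂ) ρ ∩ {z : ℂ | pairQ a b z ≠ 0}) :=
    isOpen_ball.inter (isOpen_ne_fun (continuous_pairQ a b) continuous_const)
  have hxU : (x : ℂ) ∈ ball (a : ℂ) ρ ∩ {z : ℂ | pairQ a b z ≠ 0} := ⟨hxball, hqx⟩
  have hEq : h =ᶠ[nhds (x : ℂ)] fun z => G z / pairQ a b z := by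
    refine Filter.eventually_of_mem (hU.mem_nhds hxU) ?_
    rintro z ⟨hz, hqz⟩
    have hqz' : pairQ a b z ≠ 0 := hqz
    have := hG z hz
    simp only
    rw [this, mul_div_cancel_left₀ _ hqz']
  exact ⟨hEq.eq_of_nhds, hEq.deriv_eq, hEq.deriv.deriv_eq⟩

/-- ★★★ §K.27 **TRACKED ISOLATED PAIR ⇒ TILT-READY, G-ONLY FORM.** `f` real, `G := f^{(j)}` holomorphic on `ball a ρ`; a SIMPLE zero `a + ib` (`0 < b < r < ρ`) such that
`a ± ib` are `G`'s only zeros in the ball; the CIRCLE clause `‖q·G′/G − q′‖ < 2r` on `‖z − a‖ = r`; the CONVEXITY clause on the diameter for the explicit quotient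
`F := G/q`: `((x−a)²+b²)·(|Re F″|·|Re F| + 2(Re F′)²) ≤ 2(Re F)²`; and the range clause `|a − x₀| + r ≤ (j+3)R/2` ⇒ `TiltReady ∧ ReadyR2` at level `j` (every `u`). -/
theorem readyR2_of_tracked_pair {f : ℂ → ℂ} {j : ℕ} {a b r ρ x₀ : ℝ} (η s hmax R Hs : ℝ) (B : ℕ) (u : ℂ)
    (hf : ∀ z : ℂ, f (conj z) = conj (f z))
    (hD : DifferentiableOn ℂ (iteratedDeriv j f) (ball (a : ℂ) ρ))
    (hb : 0 < b) (hbr : b < r) (hrρ : r < ρ)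
    (hz : iteratedDeriv j f (a + b * I) = 0) (hz' : deriv (iteratedDeriv j f) (a + b * I) ≠ 0)
    (honly : ∀ z ∈ ball (a : ℂ) ρ, iteratedDeriv j f z = 0 → z = a + b * I ∨ z = a - b * I)
    (hcirc : ∀ z : ℂ, ‖z - a‖ = r →
      ‖pairQ a b z * (deriv (iteratedDeriv j f) z / iteratedDeriv j f z) - 2 * (z - a)‖ < 2 * r)
    (hconv : ∀ x : ℝ, |x - a| < r →
      ((x - a) ^ 2 + b ^ 2) *
          (|(deriv (deriv (fun z => iteratedDeriv j f z / pairQ a b z)) x).re| * |(iteratedDeriv j f x / pairQ a b x).re| +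
            2 * (deriv (fun z => iteratedDeriv j f z / pairQ a b z) x).re ^ 2) ≤
        2 * (iteratedDeriv j f x / pairQ a b x).re ^ 2)
    (hwin : |a - x₀| + r ≤ ((j : ℝ) + 3) * R / 2) :
    RhW08.StSwap.TiltReady η f x₀ s hmax R Hs B j u ∧ RhW08.StSwap.ReadyR2 η f x₀ s hmax R Hs B j u := by
  have hGreal := Literature.NumberTheory.LFunctions.iteratedDeriv_conj_of_conj hf j
  have hbρ : |b| < ρ := by rw [abs_of_pos hb]; linarith
  obtain ⟨h, hh, hh0, hG⟩ := exists_pair_factor_real hGreal hb.ne' hbρ hD hz hz' honly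
  have hr : 0 < r := hb.trans hbr
  have hq : ∀ z : ℂ, ‖z - a‖ = r → pairQ a b z ≠ 0 := fun z hz =>
    pairQ_ne_zero_of_circle (by rwa [abs_of_pos hb]) hz
  have hsmall := hsmall_of_logDeriv hrρ hh hh0 hG hq hcirc
  have hsmall2 : ∀ x : ℝ, |x - a| < r →
      ((x - a) ^ 2 + b ^ 2) * (|(deriv (deriv h) x).re| * |(h x).re| + 2 * (deriv h x).re ^ 2) ≤ 2 * (h x).re ^ 2 := by
    intro x hx
    obtain ⟨e0, e1, e2⟩ := cofactor_eq_quot hb.ne' hrρ.le hG hx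
    rw [e0, e1, e2]
    exact hconv x hx
  exact readyR2_of_isolated' η s hmax R Hs B u hr hrρ hb hh hh0 hG hsmall hGreal hsmall2 hwin

end RhW08.IsolatedTilt
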